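import Mathlib
import Summits.NavierStokesRegularity.FluidComputer.GalerkinLatticePhaseSpace
import Summits.NavierStokesRegularity.FluidComputer.GalerkinOneSidedLipschitz
import HarnessLib

/-!
# Condition (C2) on the lattice `ℓ²` phase space from lattice-pairing bounds on truncated elements (instab g16, cell `ns-blowup`, 2026-08-27)

HONEST FRAMING (human ruling D-0035): nothing here is a claim about Navier–Stokes blow-up.
WHAT THIS IS NOT: not NS evidence — the GLUE between the abstract (C2) reduction of the R-β chain
(`GalerkinOneSidedLipschitz.galerkin_oneSided_uniform_transport_of_truncated`, real inner-product
space, symmetric idempotent nested truncations) and the concrete phase space of the model instance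
(`GalerkinLatticePhaseSpace`: Mathlib's `lp (fun _ : ℤ^d => V) 2` with the cube truncations).
No flow, set `W` or certificate is constructed; `A`, `B` are arbitrary functions.

THE POINT (`HOME/instab/BETA2-SPEC.md` §1 «β1 is a CHOICE, no renorming construction»): the
abstract chain wants `[InnerProductSpace ℝ E]`; the lattice toolkit is complex. Mathlib's
`InnerProductSpace.complexToReal` (a `def`, installed here with `letI` INSIDE the proof) supplies
the real structure with `⟪f, g⟫_ℝ = Re ⟪f, g⟫_ℂ = Re (Lattice.pairing f g)` and the SAME norm and
the SAME real scalar action as `lp`'s own — the statement below mentions only `lp`'s structures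
(`OneSidedLipschitzOnWith`, `lpProj`), so no instance leaks. Hence:

* `galerkin_oneSided_lattice` — for the cube truncations `P_n = lpProj _ 2 {|k|_∞ ≤ n}`, any set
  `W` (its truncated union is `P`-invariant by nesting) and a field `F = A + B(·,·)` whose one-sided linear bound `hA`, bilinear split,
  first-slot bound `hfirst` and transport bound `htransport` hold — stated with the LATTICE PAIRING
  `Re Lattice.pairing` and the `ℓ²` norm — on the truncated elements `⋃ k, P_k '' W`:
  `OneSidedLipschitzOnWith (ω + c₁ + κ) (fun y => P_n (A y + B y y)) (P_n '' W)` for every `n`,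
  i.e. the field `oneSided` of `Literature.Analysis.ODE.GalerkinConvergenceSetting` with one
  constant for all levels. The lattice-pairing hypotheses are exactly what
  `TransportCommutatorLattice` / `TransportSkewLattice` / `TransportLinearisedLattice` supply for
  the transport bilinearity (with `⇑x = Λ² û`, `Lattice.eNormSq_wmul`), once `A`, `B` are DEFINED
  on `E` (the remaining `Defs` item of (β2)).
-/

noncomputable section

namespace Summit.NavierStokesRegularity.FluidComputer.GalerkinLatticeOneSided

open Set Finset Filter Topology
open Literature.Analysis.FunctionSpaces Literature.Analysis.FunctionSpaces.Lattice
open Literature.Analysis.ODE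
open Summit.NavierStokesRegularity.FluidComputer.GalerkinLatticePhaseSpace
open Summit.NavierStokesRegularity.FluidComputer.GalerkinOneSidedLipschitz
open scoped ENNReal NNReal InnerProductSpace

variable {d : Type*} [Fintype d] [DecidableEq d]
variable {V : Type*} [NormedAddCommGroup V] [InnerProductSpace ℂ V]

/-- **Condition (C2) on the lattice `ℓ²` phase space, uniformly in the level, from lattice-pairing
bounds on truncated elements.** `E = lp (fun _ : ℤ^d => V) 2`, `P n` = the coordinate projection
onto the cube `{k : ∀ i, |k i| ≤ n}`; `A : E → E`, `B : E → E → E` arbitrary with, on the truncated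
elements `⋃ k, P k '' W` of ANY set `W` (no invariance needed: the union is invariant by nesting):
`Re ⟨A x − A y, x − y⟩ ≤ ω ‖x − y‖²`,
`B x x − B y y = B (x − y) x + B y (x − y)`, `‖B (x − y) x‖ ≤ c₁ ‖x − y‖`,
`Re ⟨B y (x − y), x − y⟩ ≤ κ ‖x − y‖²` (pairing = `Lattice.pairing` of the coefficient families).
Then for every `n`: `OneSidedLipschitzOnWith (ω + c₁ + κ) (fun y => P n (A y + B y y)) (P n '' W)`. -/
theorem galerkin_oneSided_lattice {W : Set (lp (fun _ : (d → ℤ) => V) 2)}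
    {A : lp (fun _ : (d → ℤ) => V) 2 → lp (fun _ : (d → ℤ) => V) 2}
    {B : lp (fun _ : (d → ℤ) => V) 2 → lp (fun _ : (d → ℤ) => V) 2 → lp (fun _ : (d → ℤ) => V) 2}
    {ω c₁ κ : ℝ}
    (hA : ∀ x ∈ ⋃ k : ℕ, lpProj (fun _ : (d → ℤ) => V) 2
        (Fintype.piFinset fun _ : d => Finset.Icc (-(k : ℤ)) k) '' W,
      ∀ y ∈ ⋃ k : ℕ, lpProj (fun _ : (d → ℤ) => V) 2
        (Fintype.piFinset fun _ : d => Finset.Icc (-(k : ℤ)) k) '' W,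
      (pairing (⇑(A x - A y)) (⇑(x - y))).re ≤ ω * ‖x - y‖ ^ 2)
    (hsplit : ∀ x ∈ ⋃ k : ℕ, lpProj (fun _ : (d → ℤ) => V) 2
        (Fintype.piFinset fun _ : d => Finset.Icc (-(k : ℤ)) k) '' W,
      ∀ y ∈ ⋃ k : ℕ, lpProj (fun _ : (d → ℤ) => V) 2
        (Fintype.piFinset fun _ : d => Finset.Icc (-(k : ℤ)) k) '' W,
      B x x - B y y = B (x - y) x + B y (x - y))
    (hfirst : ∀ x ∈ ⋃ k : ℕ, lpProj (fun _ : (d → ℤ) => V) 2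
        (Fintype.piFinset fun _ : d => Finset.Icc (-(k : ℤ)) k) '' W,
      ∀ y ∈ ⋃ k : ℕ, lpProj (fun _ : (d → ℤ) => V) 2
        (Fintype.piFinset fun _ : d => Finset.Icc (-(k : ℤ)) k) '' W,
      ‖B (x - y) x‖ ≤ c₁ * ‖x - y‖)
    (htransport : ∀ x ∈ ⋃ k : ℕ, lpProj (fun _ : (d → ℤ) => V) 2
        (Fintype.piFinset fun _ : d => Finset.Icc (-(k : ℤ)) k) '' W,
      ∀ y ∈ ⋃ k : ℕ, lpProj (fun _ : (d → ℤ) => V) 2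
        (Fintype.piFinset fun _ : d => Finset.Icc (-(k : ℤ)) k) '' W,
      (pairing (⇑(B y (x - y))) (⇑(x - y))).re ≤ κ * ‖x - y‖ ^ 2) :
    ∀ n : ℕ, OneSidedLipschitzOnWith (ω + c₁ + κ)
      (fun y => lpProj (fun _ : (d → ℤ) => V) 2
        (Fintype.piFinset fun _ : d => Finset.Icc (-(n : ℤ)) n) (A y + B y y))
      (lpProj (fun _ : (d → ℤ) => V) 2 (Fintype.piFinset fun _ : d => Finset.Icc (-(n : ℤ)) n) '' W) := by
  letI : InnerProductSpace ℝ (lp (fun _ : (d → ℤ) => V) 2) := InnerProductSpace.complexToReal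
  -- the real inner product is the real part of the lattice pairing
  have hre : ∀ f g : lp (fun _ : (d → ℤ) => V) 2, ⟪f, g⟫_ℝ = (pairing (⇑f) (⇑g)).re := fun f g => by
    rw [show ⟪f, g⟫_ℝ = (⟪f, g⟫_ℂ).re from rfl, inner_eq_pairing]
  -- structural data of the cube truncations
  have hPsymm : ∀ n : ℕ, ∀ a b : lp (fun _ : (d → ℤ) => V) 2,
      ⟪lpProj (fun _ : (d → ℤ) => V) 2 (Fintype.piFinset fun _ : d => Finset.Icc (-(n : ℤ)) n) a, b⟫_ℝ =
        ⟪a, lpProj (fun _ : (d → ℤ) => V) 2 (Fintype.piFinset fun _ : d => Finset.Icc (-(n : ℤ)) n) b⟫_ℝ :=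
    fun n a b => by
      show (⟪_, b⟫_ℂ).re = (⟪a, _⟫_ℂ).re
      rw [inner_lpProj_left_eq_right]
  have hPidem : ∀ n : ℕ, ∀ w : lp (fun _ : (d → ℤ) => V) 2,
      lpProj (fun _ : (d → ℤ) => V) 2 (Fintype.piFinset fun _ : d => Finset.Icc (-(n : ℤ)) n)
        (lpProj (fun _ : (d → ℤ) => V) 2 (Fintype.piFinset fun _ : d => Finset.Icc (-(n : ℤ)) n) w) =
      lpProj (fun _ : (d → ℤ) => V) 2 (Fintype.piFinset fun _ : d => Finset.Icc (-(n : ℤ)) n) w :=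
    fun n w => lpProj_idem _ w
  have hle : ∀ n k : ℕ, n ≤ k → ∀ w : lp (fun _ : (d → ℤ) => V) 2,
      lpProj (fun _ : (d → ℤ) => V) 2 (Fintype.piFinset fun _ : d => Finset.Icc (-(n : ℤ)) n)
        (lpProj (fun _ : (d → ℤ) => V) 2 (Fintype.piFinset fun _ : d => Finset.Icc (-(k : ℤ)) k) w) =
      lpProj (fun _ : (d → ℤ) => V) 2 (Fintype.piFinset fun _ : d => Finset.Icc (-(n : ℤ)) n) w :=
    fun n k h w => lpProj_cube_nested_le h w
  have hge : ∀ n k : ℕ, n ≤ k → ∀ w : lp (fun _ : (d → ℤ) => V) 2,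
      lpProj (fun _ : (d → ℤ) => V) 2 (Fintype.piFinset fun _ : d => Finset.Icc (-(k : ℤ)) k)
        (lpProj (fun _ : (d → ℤ) => V) 2 (Fintype.piFinset fun _ : d => Finset.Icc (-(n : ℤ)) n) w) =
      lpProj (fun _ : (d → ℤ) => V) 2 (Fintype.piFinset fun _ : d => Finset.Icc (-(n : ℤ)) n) w :=
    fun n k h w => lpProj_cube_nested_ge h w
  -- the three bounds in the real inner product
  have hA' : ∀ x ∈ ⋃ k : ℕ, lpProj (fun _ : (d → ℤ) => V) 2
        (Fintype.piFinset fun _ : d => Finset.Icc (-(k : ℤ)) k) '' W,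
      ∀ y ∈ ⋃ k : ℕ, lpProj (fun _ : (d → ℤ) => V) 2
        (Fintype.piFinset fun _ : d => Finset.Icc (-(k : ℤ)) k) '' W,
      ⟪A x - A y, x - y⟫_ℝ ≤ ω * ‖x - y‖ ^ 2 := fun x hx y hy => by
    rw [hre]; exact hA x hx y hy
  have ht' : ∀ x ∈ ⋃ k : ℕ, lpProj (fun _ : (d → ℤ) => V) 2
        (Fintype.piFinset fun _ : d => Finset.Icc (-(k : ℤ)) k) '' W,
      ∀ y ∈ ⋃ k : ℕ, lpProj (fun _ : (d → ℤ) => V) 2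
        (Fintype.piFinset fun _ : d => Finset.Icc (-(k : ℤ)) k) '' W,
      ⟪B y (x - y), x - y⟫_ℝ ≤ κ * ‖x - y‖ ^ 2 := fun x hx y hy => by
    rw [hre]; exact htransport x hx y hy
  exact galerkin_oneSided_uniform_transport_of_truncated
    (fun n : ℕ => lpProj (fun _ : (d → ℤ) => V) 2 (Fintype.piFinset fun _ : d => Finset.Icc (-(n : ℤ)) n))
    hPsymm hPidem hle hge hA' hsplit hfirst ht'

end Summit.NavierStokesRegularity.FluidComputer.GalerkinLatticeOneSided

end
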